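import Summits.ResolutionOfSingularities.ResolutionOfSingularities.Theorems.PurelyInseparableDim4WinCertAllFieldsScope
import HarnessLib
import HarnessLib.Audit.Tags

/-!
# Purely inseparable fourfolds — in-scope win certificates over EVERY field of characteristic `p` WITH FLAT
# ABSORPTION: the format `FCert` and its checker (cover witnesses with linear factors; flats with base children)
# [OURS · counted 0 · a certificate format for OUR frame v4, not about resolution]

Census cell «res-dim4-pi» (D-0157 DOOR 2), desk WORD #65 (c); seat res-rescue-typ-3 g8 (rescue base on loan per
director-resolution DR-E8 (4)).  Sequel of res-dim4-p-14's `…WinCertAllFields` / `…WinCertAllFieldsScope`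
(`RatWit`, `UICert`, `uiwinCertB`): those certificates need EVERY equimultiple `K`-reply of every chart to be
`𝔽_p`-rational, which fails wherever the `q`-fold locus on the exceptional divisor contains a COORDINATE FLAT
`Λ = {x_j = 0, x_t = c_t (t ∉ U)}` of positive dimension (`U` = its free coordinates) — the dominant obstruction on the
RUN 4b band (seat census: 679 / 1 105 roots at the first move).  `…FlatAbsorb` proves that B's replies along such a
flat are absorbed by A's next centre `S'` whenever `S' ∩ U = ∅`.  THIS FILE is the matching certificate KIND:

* `FWit` — a COVER WITNESS for chart `j`, coordinate `i` and linear factors `lin = [(t₁,c₁),…]`: an identity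
  `Σ_α g_α·D^{(α)}G + h·x_j = ((x_i^p − x_i)·Π_r (x_{t_r} − c_r))^N` (`fwitB`); at an equimultiple `K`-point `b`
  (`b_j = 0`) it gives `b_i ∈ 𝔽_p` unless some `b_{t_r} = c_r` (`pow_eq_zero_of_fwitB`).
* `Flat` — `(j, b0, U)`: the flat through the base point `b0` (`b0 j = 0`) with free coordinates `U`;
  `OnFlat f φ b := ∀ t ∉ U, b t = f (b0 t)`.
* `FRow = IRow × List FWit × List Flat`, `FCert = List FRow`; the checker `fwinCertB p q` (`frowOK`): a row is a
  `.mono` BLIND leaf, or its origin is not `q`-fold, or it is a MOVE row: `permB`, every `k`-rational reply is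
  harmless (`ireplyOK`) OR lies on a listed flat, every flat's BASE CHILD `stepD q S j b0 s` occurs LATER as a
  `q`-fold non-blind move row whose centre avoids `U` (`baseOK`), and the COVER holds: for every chart `j ∈ S`, every
  `i ≠ j` and every choice `τ` of one non-free coordinate per flat of the chart (`List.sections`), a passing `FWit`
  with `lin = τ` (`coverOK`) — so every equimultiple `K`-point of the chart is rational or on a flat
  (`rational_or_onFlat`, this file).
Soundness of the whole certificate over every field of characteristic `p` (`q = p`) is the sequel
`…WinCertFlatSound` (it needs `…FlatAbsorb`).  Nothing here proves resolution of singularities in dimension ≥ 4 /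
characteristic `p`; F4-C(2,2) stays OPEN; counted 0; AI work, weaker than expert review.
bears_on: LADDER-RESOLUTION:D157-DOOR2 (res-dim4-pi · F4-C ∀K column · flat absorption format).
Supports stmt-ResolutionOfSingularities-16155 (helper).
-/

set_option linter.dupNamespace false

noncomputable section
open MvPolynomial Finset
open scoped BigOperators
namespace Summit.ResolutionOfSingularities.ResolutionOfSingularities.Theorems.PIDim4

namespace WinCertFlat

open Literature.AlgebraicGeometry.Resolution
open Literature.AlgebraicGeometry.Resolution.CentreBlowup
open StepKit WinCertSound InScopeWinCert ScopeCover ScopeBlind WinCertAllFields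

variable {k : Type} [Field k] [DecidableEq k]

/-! ## 1. Cover witnesses with linear factors -/

/-- A **cover witness**: chart `j`, coordinate `i`, exponent `N`, linear factors `(t, c)` standing for `x_t − c`,
cofactors `g_α` of the Hasse derivatives and `h` of `x_j`; it claims
`Σ_α g_α·D^{(α)}G + h·x_j = ((x_i^p − x_i)·Π (x_t − c))^N`. [folklore] -/
structure FWit (k : Type) where
  /-- the chart variable -/
  j : Fin 4
  /-- the coordinate forced rational off the flats -/
  i : Fin 4
  /-- the exponent `N` -/
  N : ℕ
  /-- the linear factors `x_t − c`, one per flat of the chart -/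
  lin : List (Fin 4 × k)
  /-- cofactors of the Hasse derivatives, as (multi-index, term list) -/
  gs : List ((Fin 4 → ℕ) × Terms 4 k)
  /-- cofactor of `x_j` -/
  h : Terms 4 k

/-- The term list of `x_t − c`. [folklore] -/
def linL (tc : Fin 4 × k) : Terms 4 k := [(unitE tc.1 1, 1), (fun _ => 0, -tc.2)]

/-- The term list of `Π (x_t − c)`. [folklore] -/
def linProdL : List (Fin 4 × k) → Terms 4 k
  | [] => [(fun _ => 0, 1)]
  | tc :: rest => mulL (linL tc) (linProdL rest)

/-- **Checking a cover witness** on the chart transform `G` (term list): multi-indices in `0 < |α| < q` and the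
identity `Σ_α g_α·D^{(α)}G + h·x_j = ((x_i^p − x_i)·Π (x_t − c))^N` after collecting terms. [folklore] -/
def fwitB (p q : ℕ) (G : Terms 4 k) (w : FWit k) : Bool :=
  (w.gs.all fun ag => decide (0 < ∑ l, ag.1 l ∧ ∑ l, ag.1 l < q)) &&
    StepKit.equivB (normL (witLHS G ⟨w.j, w.i, w.N, w.gs, w.h⟩))
      (normL (powL (mulL (xPowSubX p w.i) (linProdL w.lin)) w.N))

omit [DecidableEq k] in
/-- `eval₂Hom f b (x_t − c) = b_t − f c`. [folklore] -/
theorem eval₂Hom_linL {K : Type} [Field K] (f : k →+* K) (b : Fin 4 → K) (tc : Fin 4 × k) :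
    eval₂Hom f b (evalT (linL tc)) = b tc.1 - f tc.2 := by
  simp only [linL, evalT_cons, evalT_nil, map_add, add_zero, eval₂Hom_monomial_expo, prod_pow_unitE, pow_one,
    map_one, one_mul, map_neg, pow_zero, Finset.prod_const_one, mul_one]
  ring

omit [DecidableEq k] in
/-- `eval₂Hom f b (Π (x_t − c)) = Π (b_t − f c)`. [folklore] -/
theorem eval₂Hom_linProdL {K : Type} [Field K] (f : k →+* K) (b : Fin 4 → K) :
    ∀ lin : List (Fin 4 × k), eval₂Hom f b (evalT (linProdL lin)) = (lin.map fun tc => b tc.1 - f tc.2).prod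
  | [] => by
    simp only [linProdL, evalT_cons, evalT_nil, add_zero, eval₂Hom_monomial_expo, pow_zero,
      Finset.prod_const_one, mul_one, map_one, List.map_nil, List.prod_nil]
  | tc :: rest => by
    rw [linProdL, evalT_mulL, map_mul, eval₂Hom_linL, eval₂Hom_linProdL f b rest, List.map_cons, List.prod_cons]

/-- **Soundness of a cover witness**: at a `K`-point `b` with `b_j = 0` where every Hasse derivative `D^{(α)}G`,
`0 < |α| < q`, vanishes (after `f`), `((b_i^p − b_i) · Π (b_t − f c))^N = 0`. [folklore] -/
theorem pow_eq_zero_of_fwitB {p q : ℕ} {G : Terms 4 k} {w : FWit k} (hw : fwitB p q G w = true)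
    {K : Type} [Field K] (f : k →+* K) (b : Fin 4 → K) (hbj : b w.j = 0)
    (hzero : ∀ α : Fin 4 → ℕ, 0 < ∑ l, α l → ∑ l, α l < q →
      eval₂Hom f b (hasseDeriv (expo α) (evalT G)) = 0) :
    ((b w.i ^ p - b w.i) * (w.lin.map fun tc => b tc.1 - f tc.2).prod) ^ w.N = 0 := by
  unfold fwitB at hw
  rw [Bool.and_eq_true, List.all_eq_true] at hw
  obtain ⟨hdeg, hequiv⟩ := hw
  have hid : evalT (witLHS G ⟨w.j, w.i, w.N, w.gs, w.h⟩) =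
      evalT (powL (mulL (xPowSubX p w.i) (linProdL w.lin)) w.N) := by
    rw [← evalT_normL (witLHS G _), ← evalT_normL (powL _ _)]
    exact (evalT_eq_iff_equivB _ _).mpr hequiv
  have hl : eval₂Hom f b (evalT (witLHS G ⟨w.j, w.i, w.N, w.gs, w.h⟩)) = 0 := by
    rw [witLHS, evalT_append, map_add, evalT_mulL, map_mul]
    rw [eval₂Hom_sumHasseL_eq_zero f b G w.gs fun ag hag => ?_]
    · simp only [evalT_cons, evalT_nil, add_zero, eval₂Hom_monomial_expo, prod_pow_unitE, pow_one, hbj,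
        map_one, mul_zero]
    · have hd := of_decide_eq_true (hdeg ag hag)
      exact hzero ag.1 hd.1 hd.2
  have hr : eval₂Hom f b (evalT (powL (mulL (xPowSubX p w.i) (linProdL w.lin)) w.N)) =
      ((b w.i ^ p - b w.i) * (w.lin.map fun tc => b tc.1 - f tc.2).prod) ^ w.N := by
    rw [evalT_powL, map_pow, evalT_mulL, map_mul, eval₂Hom_xPowSubX, eval₂Hom_linProdL]
  rw [← hr, ← hid, hl]

/-! ## 2. Flats, rows, the checker -/

/-- A **flat** of chart `j`: base point `b0` (`b0 j = 0`) and free coordinates `U`; its `K`-points are the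
`b` with `b t = b0 t` for `t ∉ U`. [folklore] -/
structure Flat (k : Type) where
  /-- the chart variable -/
  j : Fin 4
  /-- the base point -/
  b0 : Fin 4 → k
  /-- the free coordinates -/
  U : Finset (Fin 4)
deriving DecidableEq

/-- `b` lies on the flat `φ` (read in `K` through `f`). [folklore] -/
def OnFlat {K : Type} [Field K] (f : k →+* K) (φ : Flat k) (b : Fin 4 → K) : Prop :=
  ∀ t, t ∉ φ.U → b t = f (φ.b0 t)

/-- Decidable form of `OnFlat (RingHom.id k)`. [folklore] -/
def onFlatB (φ : Flat k) (b : Fin 4 → k) : Bool := decide (∀ t, t ∉ φ.U → b t = φ.b0 t)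

/-- A row: PR-12u's `(presented state, A's centre, blindness certificate?)`, cover witnesses, flats. [folklore] -/
abbrev FRow (k : Type) : Type := IRow k × List (FWit k) × List (Flat k)

/-- A certificate: rows, children LATER in the list. [folklore] -/
abbrev FCert (k : Type) : Type := List (FRow k)

/-- A `.mono` blindness certificate of the row passes. [folklore] -/
def fmonoBlindOK (q : ℕ) (row : FRow k) : Bool :=
  match row.1.2.2 with
  | some (.mono c w α₀ a) => blindB q row.1.1 c w α₀ a
  | _ => false

variable [Fintype k]

/-- **The base child of a flat is certified later by a MOVE avoiding the flat's free coordinates**: some later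
row presents `c`, carries no blindness certificate, is `q`-fold, its centre is permissible and disjoint from `U`.
[folklore] -/
def baseOK (q : ℕ) (rest : FCert k) (c : SData 4 k) (U : Finset (Fin 4)) : Bool :=
  rest.any fun r : FRow k => c.equivB r.1.1 && decide (r.1.2.2 = none) && permB q Finset.univ r.1.1.L &&
    permB q r.1.2.1 r.1.1.L && decide (Disjoint r.1.2.1 U)

/-- The non-free coordinates of a flat other than its chart variable, as a list (candidates `t_r`). [folklore] -/
def fixedCoords (φ : Flat k) : List (Fin 4) := (Finset.univ.filter fun t => t ∉ φ.U ∧ t ≠ φ.j).toList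

/-- **The cover check of chart `j`**: for every `i ≠ j` and every choice of one fixed coordinate per flat of the
chart, a passing cover witness with exactly those linear factors. [folklore] -/
def coverOK (p q : ℕ) (s : SData 4 k) (S : Finset (Fin 4)) (j : Fin 4) (wits : List (FWit k))
    (flats : List (Flat k)) : Bool :=
  decide (∀ i : Fin 4, i ≠ j →
    ∀ τ ∈ ((flats.filter fun φ : Flat k => decide (φ.j = j)).map fixedCoords).sections,
      ∃ w ∈ wits, w.j = j ∧ w.i = i ∧
        w.lin = List.zipWith (fun (φ : Flat k) (t : Fin 4) => (t, φ.b0 t))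
          (flats.filter fun φ : Flat k => decide (φ.j = j)) τ ∧
        fwitB p q (chartL q S j s.L) w = true)

/-- **The row check.** [folklore] -/
def frowOK (p q : ℕ) (rest : FCert k) (row : FRow k) : Bool :=
  fmonoBlindOK q row || !(permB q Finset.univ row.1.1.L) ||
    (permB q row.1.2.1 row.1.1.L &&
      decide (∀ j ∈ row.1.2.1, ∀ b : Fin 4 → k, b j = 0 →
        ireplyOK q (rest.map fun r : FRow k => r.1) row.1.1 row.1.2.1 j b = true ∨
          ∃ φ : Flat k, φ ∈ row.2.2 ∧ φ.j = j ∧ onFlatB φ b = true) &&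
      decide (∀ φ : Flat k, φ ∈ row.2.2 → φ.j ∈ row.1.2.1 ∧ φ.b0 φ.j = 0 ∧
        baseOK q rest (stepD q row.1.2.1 φ.j φ.b0 row.1.1) φ.U = true) &&
      decide (∀ j ∈ row.1.2.1, coverOK p q row.1.1 row.1.2.1 j row.2.1 row.2.2 = true))

/-- **The checker.** [folklore] -/
def fwinCertB (p q : ℕ) : FCert k → Bool
  | [] => true
  | row :: rest => frowOK p q rest row && fwinCertB p q rest

omit [Fintype k] in
/-- Soundness of `baseOK`. [folklore] -/
theorem exists_of_baseOK {q : ℕ} {rest : FCert k} {c : SData 4 k} {U : Finset (Fin 4)}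
    (h : baseOK q rest c U = true) :
    ∃ r ∈ rest, c.toState = r.1.1.toState ∧ r.1.2.2 = none ∧ permB q Finset.univ r.1.1.L = true ∧
      permB q r.1.2.1 r.1.1.L = true ∧ Disjoint r.1.2.1 U := by
  unfold baseOK at h
  obtain ⟨r, hr, hrc⟩ := List.any_eq_true.mp h
  simp only [Bool.and_eq_true, decide_eq_true_eq] at hrc
  obtain ⟨⟨⟨⟨he, hn⟩, hu⟩, hp⟩, hd⟩ := hrc
  exact ⟨r, hr, (toState_eq_iff c r.1.1).mpr he, hn, hu, hp, hd⟩

/-! ## 3. The cover: an equimultiple `K`-point is rational or lies on a flat -/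

omit [DecidableEq k] [Fintype k] in
/-- If `b` is on no flat of the list, one can choose a fixed coordinate per flat where `b` differs from the base
point, and the choice is a section of `fixedCoords`. [folklore] -/
theorem exists_section_of_forall_not_onFlat {K : Type} [Field K] (f : k →+* K) {j : Fin 4} {b : Fin 4 → K}
    (hbj : b j = 0) :
    ∀ (flats : List (Flat k)), (∀ φ ∈ flats, φ.j = j) → (∀ φ ∈ flats, φ.b0 φ.j = 0) →
      (∀ φ ∈ flats, ¬ OnFlat f φ b) →
      ∃ τ ∈ (flats.map fixedCoords).sections,
        ((List.zipWith (fun (φ : Flat k) (t : Fin 4) => (t, φ.b0 t)) flats τ).map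
          fun tc : Fin 4 × k => b tc.1 - f tc.2).prod ≠ 0
  | [], _, _, _ => ⟨[], by simp [List.sections], by simp⟩
  | φ :: rest, hj, h0, hnot => by
    classical
    obtain ⟨τ, hτ, hprod⟩ := exists_section_of_forall_not_onFlat f hbj rest
      (fun ψ hψ => hj ψ (List.mem_cons_of_mem _ hψ)) (fun ψ hψ => h0 ψ (List.mem_cons_of_mem _ hψ))
      (fun ψ hψ => hnot ψ (List.mem_cons_of_mem _ hψ))
    have hφ : ¬ OnFlat f φ b := hnot φ List.mem_cons_self
    unfold OnFlat at hφ
    push Not at hφ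
    obtain ⟨t, htU, hne⟩ := hφ
    have htj : t ≠ φ.j := by
      intro h
      apply hne
      rw [h, h0 φ List.mem_cons_self, map_zero, hj φ List.mem_cons_self, hbj]
    refine ⟨t :: τ, ?_, ?_⟩
    · rw [List.map_cons, List.sections]
      simp only [List.mem_flatMap, List.mem_map]
      refine ⟨τ, hτ, t, ?_, rfl⟩
      rw [fixedCoords, Finset.mem_toList, Finset.mem_filter]
      exact ⟨Finset.mem_univ t, htU, htj⟩
    · rw [List.zipWith_cons_cons, List.map_cons, List.prod_cons]
      exact mul_ne_zero (sub_ne_zero.mpr hne) hprod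

/-- **THE COVER.** At a move row whose chart `j ∈ S` passes `coverOK`, every equimultiple `K`-point `b` of the chart
(`b_j = 0`) is `f ∘ b₀` for a `k`-point `b₀` with `b₀ j = 0`, or lies on a flat of the chart. [folklore] -/
theorem rational_or_onFlat {p : ℕ} [Fact p.Prime] {q : ℕ} {K : Type} [Field K] [CharP K p] [DecidableEq K]
    (f : ZMod p →+* K) {s : SData 4 (ZMod p)} {S : Finset (Fin 4)} {j : Fin 4} {wits : List (FWit (ZMod p))}
    {flats : List (Flat (ZMod p))} (hcov : coverOK p q s S j wits flats = true)
    (h0 : ∀ φ ∈ flats, φ.b0 φ.j = 0) {b : Fin 4 → K} (hbj : b j = 0)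
    (heq : IsEquimultiplePoint q S j b (⟨MvPolynomial.map f s.toState.F, s.toState.r, s.toState.exc⟩ : State K)) :
    (∃ b₀ : Fin 4 → ZMod p, b₀ j = 0 ∧ f ∘ b₀ = b) ∨ ∃ φ ∈ flats, φ.j = j ∧ OnFlat f φ b := by
  classical
  by_cases hflat : ∃ φ ∈ flats, φ.j = j ∧ OnFlat f φ b
  · exact Or.inr hflat
  left
  push Not at hflat
  unfold coverOK at hcov
  have hall := of_decide_eq_true hcov
  set fl := flats.filter fun φ => φ.j = j with hfl
  have hflj : ∀ φ ∈ fl, φ.j = j := fun φ hφ => (List.mem_filter.mp hφ).2 |> of_decide_eq_true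
  have hfl0 : ∀ φ ∈ fl, φ.b0 φ.j = 0 := fun φ hφ => h0 φ (List.mem_filter.mp hφ).1
  have hnot : ∀ φ ∈ fl, ¬ OnFlat f φ b := fun φ hφ => hflat φ (List.mem_filter.mp hφ).1 (hflj φ hφ)
  obtain ⟨τ, hτ, hprod⟩ := exists_section_of_forall_not_onFlat f hbj fl hflj hfl0 hnot
  have hcoord : ∀ i : Fin 4, ∃ c : ZMod p, f c = b i := by
    intro i
    by_cases hij : i = j
    · exact ⟨0, by rw [map_zero, hij, hbj]⟩
    · obtain ⟨w, -, hwj, hwi, hwlin, hw⟩ := hall i hij τ hτ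
      have hpow := pow_eq_zero_of_fwitB hw f b (by rw [hwj]; exact hbj)
        (fun α hα0 hαq => eval₂Hom_hasseDeriv_eq_zero_of_isEquimultiplePoint f s heq α hα0 hαq)
      rw [hwi, hwlin] at hpow
      rcases Nat.eq_zero_or_pos w.N with hN | hN
      · rw [hN, pow_zero] at hpow; exact absurd hpow one_ne_zero
      have hmul := (pow_eq_zero_iff hN.ne').mp hpow
      rcases mul_eq_zero.mp hmul with h1 | h2
      · exact exists_eq_cast_of_pow_char_eq f (sub_eq_zero.mp h1)
      · exact absurd h2 hprod
  choose b₀ hb₀ using hcoord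
  refine ⟨b₀, ?_, funext fun i => hb₀ i⟩
  have : f (b₀ j) = f 0 := by rw [hb₀ j, hbj, map_zero]
  exact f.injective this

omit [Fintype k] in
/-- A `k`-rational point on a flat (Boolean form) is on the flat over `K`. [folklore] -/
theorem onFlat_of_onFlatB {K : Type} [Field K] (f : k →+* K) {φ : Flat k} {b₀ : Fin 4 → k}
    (h : onFlatB φ b₀ = true) : OnFlat f φ (f ∘ b₀) := by
  unfold onFlatB at h
  intro t ht
  rw [Function.comp_apply, of_decide_eq_true h t ht]

omit [DecidableEq k] [Fintype k] in
/-- On a flat, `b = f ∘ b0 + v` with `v` vanishing off `U`. [folklore] -/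
theorem exists_add_of_onFlat {K : Type} [Field K] (f : k →+* K) {φ : Flat k} {b : Fin 4 → K}
    (h : OnFlat f φ b) : ∃ v : Fin 4 → K, (∀ t, t ∉ φ.U → v t = 0) ∧ b = f ∘ φ.b0 + v := by
  refine ⟨b - f ∘ φ.b0, fun t ht => ?_, by rw [add_sub_cancel]⟩
  · rw [Pi.sub_apply, Function.comp_apply, h t ht, sub_self]

end WinCertFlat

end Summit.ResolutionOfSingularities.ResolutionOfSingularities.Theorems.PIDim4

end
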